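import Literature.NumberTheory.Weil1964.ThetaWeightForms
import Literature.NumberTheory.Automorphic.WeightFormsArchRestriction
import HarnessLib

/-!
# Theta classes and the supply of a nonzero theta class (W6b-2)

How a space `Θ ≤ weightForms ΓU κ τ` of ADELIC weight forms (e.g. the theta forms
`ThetaKernelDatum.thetaForms` of `Literature.NumberTheory.Weil1964.ThetaWeightForms`) produces a set of
degree-one cohomology CLASSES, abstractly over the datum the geometric side exports, and why ONE scalar
non-vanishing ON the archimedean component plus holomorphy of the restricted form supplies a NONZERO class.

* `ClassMapDatum ι hΔ hη H` — what the class map of a ball quotient provides, in the DATA direction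
  "class ↦ ball function": the `(1,0)`-piece `H10 ≤ H` of (complexified) degree-one cohomology, the linear
  pullback `pull : H10 → weightForms Δ κ₁ τ₁` (harmonic representative, pulled back to the group), the
  subspace `Hol` of holomorphic classical weight forms, and the DESCENT property `descends` (every
  holomorphic weight form is the pullback of a `(1,0)`-class — Dolbeault/Hodge on the compact quotient;
  supplied by the geometric seat as a proved theorem or a cited record, NOT assumed here beyond the field).
* `thetaClasses ι D Θ : Set H` — the classes `c ∈ H10` whose pullback is the archimedean restriction
  (`WeightForms.restrictHom ι hΔ hη`) of some `F ∈ Θ` that is holomorphic after restriction; they lie in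
  `H10` (`thetaClasses_subset`), contain `0`, and grow with `Θ`.
* `exists_ne_zero_of_apply_ne_zero` — `F ∈ Θ`, `F (ι x) ≠ 0` for some `x` in the component group and
  `restrictHom F ∈ Hol` ⇒ a NONZERO element of `thetaClasses` (descent gives the class; it is nonzero
  because its pullback `restrictHom F` is, by `restrictHom_ne_zero_of_apply_ne_zero`).
* `ThetaKernelDatum.exists_thetaClass_ne_zero` — the theta instance: `Θ = thetaForms 𝓙 𝓕`,
  `F = thetaForm j f`, and the non-vanishing read off ONE scalar lift value
  `Θ̃_{j(ι ℓ)}(f)(ι_∞ x) ≠ 0` (`thetaForm_apply_ne_zero`).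

Injectivity of the class map is NOT needed for supply (only for placement statements elsewhere).
Everything is linear-algebra bookkeeping [folklore]; the two analytic inputs — the scalar non-vanishing
and the holomorphy of the restricted theta form — enter as hypotheses of the final theorems.
-/

open Function Module MeasureTheory

namespace Literature.NumberTheory.Automorphic.WeightForms

variable {GU : Type*} [Group GU] {G₁ : Type*} [Group G₁]
variable {Kc : Type*} [Group Kc] {K₁ : Type*} [Group K₁]
variable {W : Type*} [AddCommGroup W] [Module ℂ W]
variable {ΓU : Subgroup GU} {κ : Kc →* GU} {τ : Representation ℂ Kc W}
variable (ι : G₁ →* GU) {Δ : Subgroup G₁} {κ₁ : K₁ →* G₁} {τ₁ : Representation ℂ K₁ W}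

/-- **Class-map datum** over the restriction situation `ι : G₁ →* GU` (`hΔ`, `hη` as in
`WeightForms.restrictHom`) and a coefficient space `H` (degree-one complexified cohomology of the
quotient): the `(1,0)`-piece `H10`, the linear pullback `pull : H10 → weightForms Δ κ₁ τ₁` of classes to
classical weight forms on the group, the holomorphic subspace `Hol`, and DESCENT: every `f ∈ Hol` is
`pull c` for some class `c`. [folklore] -/
structure ClassMapDatum (hΔ : IsLevelCorrected ΓU κ τ ι Δ) {η₁ : K₁ →* Kc}
    (hη : IsWeightMatched κ τ ι κ₁ τ₁ η₁) (H : Type*) [AddCommGroup H] [Module ℂ H] where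
  /-- The `(1,0)`-classes. -/
  H10 : Submodule ℂ H
  /-- Pullback of a `(1,0)`-class to a classical weight form on `G₁` (harmonic representative). -/
  pull : H10 →ₗ[ℂ] weightForms Δ κ₁ τ₁
  /-- The holomorphic classical weight forms. -/
  Hol : Submodule ℂ (weightForms Δ κ₁ τ₁)
  /-- Descent: every holomorphic weight form is the pullback of a `(1,0)`-class. -/
  descends : ∀ f ∈ Hol, ∃ c : H10, pull c = f

variable {hΔ : IsLevelCorrected ΓU κ τ ι Δ} {η₁ : K₁ →* Kc} {hη : IsWeightMatched κ τ ι κ₁ τ₁ η₁}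
variable {H : Type*} [AddCommGroup H] [Module ℂ H]

/-- **Theta classes** of a space of adelic forms `Θ`: the `(1,0)`-classes whose pullback is the
archimedean restriction of some `F ∈ Θ` holomorphic after restriction. [folklore] -/
def thetaClasses (D : ClassMapDatum ι hΔ hη H) (Θ : Submodule ℂ (weightForms ΓU κ τ)) : Set H :=
  {h | ∃ c : D.H10, (c : H) = h ∧ ∃ F ∈ Θ, restrictHom ι hΔ hη F ∈ D.Hol ∧ D.pull c = restrictHom ι hΔ hη F}

/-- Membership unfolded. [folklore] -/
theorem mem_thetaClasses_iff (D : ClassMapDatum ι hΔ hη H) (Θ : Submodule ℂ (weightForms ΓU κ τ))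
    (h : H) : h ∈ thetaClasses ι D Θ ↔ ∃ c : D.H10, (c : H) = h ∧
      ∃ F ∈ Θ, restrictHom ι hΔ hη F ∈ D.Hol ∧ D.pull c = restrictHom ι hΔ hη F :=
  Iff.rfl

/-- Theta classes are `(1,0)`-classes. [folklore] -/
theorem thetaClasses_subset (D : ClassMapDatum ι hΔ hη H) (Θ : Submodule ℂ (weightForms ΓU κ τ)) :
    thetaClasses ι D Θ ⊆ D.H10 := by
  rintro _ ⟨c, rfl, -⟩
  exact c.2

/-- The zero class is a theta class (witnessed by `F = 0`). [folklore] -/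
theorem zero_mem_thetaClasses (D : ClassMapDatum ι hΔ hη H) (Θ : Submodule ℂ (weightForms ΓU κ τ)) :
    (0 : H) ∈ thetaClasses ι D Θ :=
  ⟨0, rfl, 0, Θ.zero_mem, by rw [map_zero]; exact D.Hol.zero_mem, by rw [map_zero, map_zero]⟩

/-- Monotonicity in the space of adelic forms. [folklore] -/
theorem thetaClasses_mono (D : ClassMapDatum ι hΔ hη H) {Θ Θ' : Submodule ℂ (weightForms ΓU κ τ)}
    (h : Θ ≤ Θ') : thetaClasses ι D Θ ⊆ thetaClasses ι D Θ' := by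
  rintro _ ⟨c, rfl, F, hF, hHol, hc⟩
  exact ⟨c, rfl, F, h hF, hHol, hc⟩

/-- A class whose pullback is the restriction of a holomorphic-after-restriction `F ∈ Θ` is a theta
class (the defining witness, packaged). [folklore] -/
theorem mem_thetaClasses_of_pull_eq (D : ClassMapDatum ι hΔ hη H) {Θ : Submodule ℂ (weightForms ΓU κ τ)}
    {F : weightForms ΓU κ τ} (hFΘ : F ∈ Θ) (hHol : restrictHom ι hΔ hη F ∈ D.Hol) {c : D.H10}
    (hc : D.pull c = restrictHom ι hΔ hη F) : (c : H) ∈ thetaClasses ι D Θ :=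
  ⟨c, rfl, F, hFΘ, hHol, hc⟩

/-- **Supply of a nonzero theta class**: an adelic form `F ∈ Θ`, non-vanishing ON the archimedean
component (`F (ι x) ≠ 0`) and holomorphic after restriction yields a NONZERO theta class: descent gives a
class `c` with `pull c = restrictHom F`, and `c ≠ 0` because `restrictHom F ≠ 0`. [folklore] -/
theorem exists_ne_zero_of_apply_ne_zero (D : ClassMapDatum ι hΔ hη H) {Θ : Submodule ℂ (weightForms ΓU κ τ)}
    {F : weightForms ΓU κ τ} (hFΘ : F ∈ Θ) {x : G₁} (hx : (F : GU → W) (ι x) ≠ 0)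
    (hHol : restrictHom ι hΔ hη F ∈ D.Hol) : ∃ h ∈ thetaClasses ι D Θ, h ≠ 0 := by
  obtain ⟨c, hc⟩ := D.descends _ hHol
  refine ⟨c, ⟨c, rfl, F, hFΘ, hHol, hc⟩, fun h0 => ?_⟩
  have hc0 : c = 0 := Subtype.ext h0
  refine restrictHom_ne_zero_of_apply_ne_zero ι hΔ hη hx ?_
  rw [← hc, hc0, map_zero]

/-- The same with the conclusion inside `H10`: a nonzero `(1,0)`-class that is a theta class. [folklore] -/
theorem exists_mem_H10_ne_zero_of_apply_ne_zero (D : ClassMapDatum ι hΔ hη H)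
    {Θ : Submodule ℂ (weightForms ΓU κ τ)} {F : weightForms ΓU κ τ} (hFΘ : F ∈ Θ) {x : G₁}
    (hx : (F : GU → W) (ι x) ≠ 0) (hHol : restrictHom ι hΔ hη F ∈ D.Hol) :
    ∃ c : D.H10, (c : H) ∈ thetaClasses ι D Θ ∧ c ≠ 0 := by
  obtain ⟨c, hc⟩ := D.descends _ hHol
  refine ⟨c, ⟨c, rfl, F, hFΘ, hHol, hc⟩, fun hc0 => ?_⟩
  refine restrictHom_ne_zero_of_apply_ne_zero ι hΔ hη hx ?_
  rw [← hc, hc0, map_zero]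

end Literature.NumberTheory.Automorphic.WeightForms

/-! ## The theta instance: `Θ = thetaForms 𝓙 𝓕`, `F = thetaForm j f` -/

namespace Literature.NumberTheory.Weil1964.ThetaKernelDatum

open Literature.NumberTheory.Automorphic Literature.NumberTheory.Automorphic.WeightForms

variable {Mp : Type*} {SX : Type*} [TopologicalSpace Mp] [Group Mp] [TopologicalSpace SX]
variable {GU : Type*} [Group GU] [TopologicalSpace GU] [IsTopologicalGroup GU] {ΓU : Subgroup GU}
variable {G : Type*} [Group G] [TopologicalSpace G] [IsTopologicalGroup G] {Γ : Subgroup G}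
variable (M : ThetaKernelDatum Mp SX GU ΓU G Γ)
variable [AddCommGroup SX] [Module ℂ SX]
variable [CompactSpace (GU ⧸ ΓU)] [CompactSpace (G ⧸ Γ)] [MeasurableSpace (G ⧸ Γ)] [BorelSpace (G ⧸ Γ)]
  (μ : Measure (G ⧸ Γ)) [IsFiniteMeasure μ] (hlin : M.W.ThetaLinear)
variable {Kc : Type*} [Group Kc] (κ : Kc →* GU)
variable {E : Type*} [AddCommGroup E] [Module ℂ E] (σ : Representation ℂ Kc E)
variable {W : Type*} [AddCommGroup W] [Module ℂ W] [IsReflexive ℂ W] {τ : Representation ℂ Kc W}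
variable (ι : Dual ℂ W →ₗ[ℂ] E) (hι : ∀ (k : Kc) (ℓ : Dual ℂ W), ι (τ.dual k ℓ) = σ k (ι ℓ))
variable {G₁ : Type*} [Group G₁] {K₁ : Type*} [Group K₁] (ιinf : G₁ →* GU) {Δ : Subgroup G₁}
  {κ₁ : K₁ →* G₁} {τ₁ : Representation ℂ K₁ W} {hΔ : IsLevelCorrected ΓU κ τ ιinf Δ} {η₁ : K₁ →* Kc}
  {hη : IsWeightMatched κ τ ιinf κ₁ τ₁ η₁} {H : Type*} [AddCommGroup H] [Module ℂ H]

/-- **Supply, theta instance**: a theta-equivariant test family `j ∈ 𝓙`, a weight function `f ∈ 𝓕`, ONE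
scalar lift value `Θ̃_{j(ι ℓ)}(f)(ι_∞ x) ≠ 0` on the archimedean component, and holomorphy of the restricted
theta form `restrictHom ι_∞ (thetaForm j f)` give a NONZERO class in `thetaClasses D (thetaForms 𝓙 𝓕)`.
[folklore] -/
theorem exists_thetaClass_ne_zero (D : ClassMapDatum ιinf hΔ hη H)
    {𝓙 : Set {j : E →ₗ[ℂ] SX // M.IsThetaEquivariant κ σ j}} {𝓕 : Set C(G ⧸ Γ, ℂ)}
    {j : {j : E →ₗ[ℂ] SX // M.IsThetaEquivariant κ σ j}} (hj : j ∈ 𝓙) {f : C(G ⧸ Γ, ℂ)} (hf : f ∈ 𝓕)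
    {ℓ : Dual ℂ W} {x : G₁} (h : M.thetaLiftFun μ (j.1 (ι ℓ)) f (ιinf x) ≠ 0)
    (hHol : restrictHom ιinf hΔ hη (M.thetaForm μ hlin κ j.1 j.2 ι hι f) ∈ D.Hol) :
    ∃ c ∈ thetaClasses ιinf D (M.thetaForms μ hlin κ σ ι hι 𝓙 𝓕), c ≠ 0 :=
  exists_ne_zero_of_apply_ne_zero ιinf D (M.thetaForm_mem_thetaForms μ hlin κ σ ι hι hj hf)
    (M.thetaForm_apply_ne_zero μ hlin κ j.1 j.2 ι hι f h) hHol

/-- The same with the class produced inside `H10`. [folklore] -/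
theorem exists_thetaClass_mem_H10_ne_zero (D : ClassMapDatum ιinf hΔ hη H)
    {𝓙 : Set {j : E →ₗ[ℂ] SX // M.IsThetaEquivariant κ σ j}} {𝓕 : Set C(G ⧸ Γ, ℂ)}
    {j : {j : E →ₗ[ℂ] SX // M.IsThetaEquivariant κ σ j}} (hj : j ∈ 𝓙) {f : C(G ⧸ Γ, ℂ)} (hf : f ∈ 𝓕)
    {ℓ : Dual ℂ W} {x : G₁} (h : M.thetaLiftFun μ (j.1 (ι ℓ)) f (ιinf x) ≠ 0)
    (hHol : restrictHom ιinf hΔ hη (M.thetaForm μ hlin κ j.1 j.2 ι hι f) ∈ D.Hol) :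
    ∃ c : D.H10, (c : H) ∈ thetaClasses ιinf D (M.thetaForms μ hlin κ σ ι hι 𝓙 𝓕) ∧ c ≠ 0 :=
  exists_mem_H10_ne_zero_of_apply_ne_zero ιinf D (M.thetaForm_mem_thetaForms μ hlin κ σ ι hι hj hf)
    (M.thetaForm_apply_ne_zero μ hlin κ j.1 j.2 ι hι f h) hHol

end Literature.NumberTheory.Weil1964.ThetaKernelDatum
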